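import Summits.SmoothPoincare4.SmoothPoincare4.Theorems.SullivanDualWitnessChargeStubCollarBound

/-!
# Collar lemma for taming witnesses (5/5): a witness has no mass on the `i`-convex collar

Stub `stub_collar` of the line `Sketch` (pencil-incompleteness) of the crux `WitnessCharge`
(`stmt-SmoothPoincare4-7824`, thesis `SullivanDual`): for `J` standard on the punctured
`ε'`-chart-ball at `p` (closed `ε'`-ball inside the chart target), `0 < ε < ε₂ < ε'`, a smooth
form `β` taming `J` everywhere, and a taming witness `T` at radius `ε`
(`Literature.Geometry.Symplectic.TamingWitness`), every smooth `2`-form `α` vanishing off the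
punctured `ε₂`-ball is killed by `T`.

Proof (Gromov's `i`-convex collar, read through Sullivan's duality):
1. *Positivity* (`stub_collar_positivity`, file 1/5): a smooth form that is
   `J`-semipositive off the `ε`-ball has `T α ≥ 0`.
2. *The collar form*: with a smooth monotone profile `f`, `f ≡ 0` below `δ⁻²`, `f ≡ 1` above
   `ε⁻²` (`ε₂ < δ < ε'`), the cut-off pull-back `Φ` of the flat collar form
   `Ψ = d(½ f(‖y‖²) ω₀(y, ·))` (files 2/5, 3/5) is smooth, closed, standard on the `ε`-ball and
   `J`-semipositive, so (W3) gives `T Φ ≤ 0` and positivity `T Φ ≥ 0`: `T Φ = 0`; moreover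
   `Φ(v, Jv) ≥ m ‖A v‖²` wherever `‖e x - e p‖ ≤ ε₂`, `m = f(ε₂⁻²) > 0`.
3. *Killing*: by the domination bound `stub_collar_domination` of file 4/5 (compactness of the complement of the
   `ε`-ball), `|α(v, Jv)| ≤ C ‖A v‖²` off the `ε`-ball, so `Φ ± (m/(C+1)) α` is
   `J`-semipositive off the ball and positivity gives `± T α ≥ 0`.

## References

* M. Gromov, *Pseudo holomorphic curves in symplectic manifolds*, Invent. Math. 82 (1985),
  §0.3.C, 2.4.A. [Gromov1985]
* D. Sullivan, *Cycles for the dynamical study of foliated manifolds and complex manifolds*,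
  Invent. Math. 36 (1976), Thm. I.7. [Sullivan1976]
-/

noncomputable section

-- Justification: all stub files of the line share the namespace of the skeleton
-- (`…Theorems.WitnessCharge.PencilIncompleteness`), which repeats the component `SmoothPoincare4`.
set_option linter.dupNamespace false

open scoped Manifold ContDiff Topology RealInnerProductSpace
open Set Filter Literature.Geometry.Kaehler Literature.Geometry.Symplectic
  Literature.Topology.FourManifolds

namespace Summit.SmoothPoincare4.SmoothPoincare4.Theorems.WitnessCharge.PencilIncompleteness

/-- STEP 0(b) — **COLLAR LEMMA**: for `J` standard on the punctured `ε'`-ball (closed ball inside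
the chart target), `0 < ε < ε₂ < ε'`, a smooth form `β` taming `J` everywhere and a taming
witness `T` at radius `ε`, every smooth `2`-form `α` vanishing off `B_{ε₂}` is killed by `T`.
Proof: with `ρ = ‖ι(e x − e p)‖²` and a smooth monotone profile `f`, `f ≡ 0` below `δ⁻²`
(`ε₂ < δ < ε'`), `f ≡ 1` above `ε⁻²`, the cut-off pull-back `Φ` of `d(½ f(ρ) ω₀(y, ·)) =
f ω₀ + ½ f' dρ ∧ ω₀(y, ·)` is smooth, closed, standard on `B_ε` and `J`-semipositive, so (W3)
`T Φ ≤ 0` while positivity ((W1) with the taming form `β`) gives `T Φ ≥ 0`: `T Φ = 0`; and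
`Φ(v, Jv) ≥ f(ε₂⁻²) ‖A v‖²` on the support of `α` off `B_ε`, where `|α(v, Jv)| ≤ C ‖A v‖²`
(compactness of `Σ ∖ B_ε`), so `Φ ± t α` is `J`-semipositive off `B_ε` for small `t > 0` and
positivity gives `± T α ≥ 0`. [cite: Gromov1985, 2.4.A] -/
theorem stub_collar :
    ∀ (S : HomotopySphere 4) (p : S.carrier)
      (J : ∀ x : punctured p, TangentSpace (𝓡 4) x →L[ℝ] TangentSpace (𝓡 4) x) (ε ε' : ℝ),
      0 < ε → ε < ε' →
      Metric.closedBall (extChartAt (𝓡 4) p p) ε' ⊆ (extChartAt (𝓡 4) p).target →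
      (∀ x : punctured p, InPuncturedChartBall p ε' x →
        ∀ (v : TangentSpace (𝓡 4) x) (b : EuclideanSpace ℝ (Fin 4)),
          inner ℝ (fderiv ℝ inversion (extChartAt (𝓡 4) p x.1 - extChartAt (𝓡 4) p p)
            (mfderiv (𝓡 4) 𝓘(ℝ, EuclideanSpace ℝ (Fin 4))
              (fun z : punctured p => extChartAt (𝓡 4) p z.1) x (J x v))) b
          = stdSymplecticForm (fderiv ℝ inversion (extChartAt (𝓡 4) p x.1 - extChartAt (𝓡 4) p p)
            (mfderiv (𝓡 4) 𝓘(ℝ, EuclideanSpace ℝ (Fin 4))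
              (fun z : punctured p => extChartAt (𝓡 4) p z.1) x v)) b) →
      ∀ (β : MForm (𝓡 4) (punctured p) ℝ 2), IsSmoothForm β →
      (∀ (x : punctured p) (v : TangentSpace (𝓡 4) x), v ≠ 0 → 0 < β x ![v, J x v]) →
      ∀ (T : MForm (𝓡 4) (punctured p) ℝ 2 →ₗ[ℝ] ℝ), TamingWitness p ε J T →
      ∀ (ε₂ : ℝ), ε < ε₂ → ε₂ < ε' →
      ∀ (α : MForm (𝓡 4) (punctured p) ℝ 2), IsSmoothForm α →
        (∀ x : punctured p, ¬ InPuncturedChartBall p ε₂ x → α x = 0) → T α = 0 := by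
  intro S p J ε ε' hε hεε' hball hJstd β hβ hβt T hT ε₂ hε₂ hε₂' α hα hα0
  -- radii
  set δ : ℝ := (ε₂ + ε') / 2 with hδ
  have hδ0 : 0 < δ := by linarith
  have hε₂δ : ε₂ < δ := by linarith
  have hδε' : δ < ε' := by linarith
  have hεδ : ε < δ := by linarith
  have hε₂0 : 0 < ε₂ := hε.trans hε₂
  have hab : (δ⁻¹) ^ 2 < (ε⁻¹) ^ 2 :=
    pow_lt_pow_left₀ ((inv_lt_inv₀ hδ0 hε).2 hεδ) (inv_nonneg.2 hδ0.le) two_ne_zero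
  have ha₂ : (δ⁻¹) ^ 2 < (ε₂⁻¹) ^ 2 :=
    pow_lt_pow_left₀ ((inv_lt_inv₀ hδ0 hε₂0).2 hε₂δ) (inv_nonneg.2 hδ0.le) two_ne_zero
  have hδT : Metric.closedBall (extChartAt (𝓡 4) p p) δ ⊆ (extChartAt (𝓡 4) p).target :=
    (Metric.closedBall_subset_closedBall hδε'.le).trans hball
  -- the profile and the flat collar form
  obtain ⟨f, hfs, hfm, hfnn, hf', hf0, hf1, hfpos⟩ := exists_smooth_profile hab
  obtain ⟨Ψ, hΨs, hΨc, hΨconst, hΨzero, hΨpos⟩ := stub_collar_flatCollarForm f hfs hf'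
  have hΨ0 : ∀ y : EuclideanSpace ℝ (Fin 4), ‖y‖ ^ 2 < (δ⁻¹) ^ 2 → Ψ y = 0 := fun y hy =>
    hΨzero y (hf0 _ hy)
  have hΨ1 : ∀ y : EuclideanSpace ℝ (Fin 4), (ε⁻¹) ^ 2 < ‖y‖ ^ 2 →
      ∀ u w : EuclideanSpace ℝ (Fin 4), Ψ y ![u, w] = stdSymplecticForm u w := fun y hy u w => by
    rw [hΨconst y 1 (hf1 _ hy) u w, one_mul]
  -- the collar form `Φ`: cut-off pull-back of `Ψ` along the inverted recentred chart
  set Φ : MForm (𝓡 4) (punctured p) ℝ 2 :=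
    MForm.restr {x : punctured p | InPuncturedChartBall p ε' x}
      (MForm.pullback (𝓡 4) (fun z : punctured p =>
        inversion (extChartAt (𝓡 4) p z.1 - extChartAt (𝓡 4) p p)) Ψ) with hΦ
  have hΦin : ∀ x : punctured p, InPuncturedChartBall p ε' x → Φ x =
      (MForm.pullback (𝓡 4) (fun z : punctured p =>
        inversion (extChartAt (𝓡 4) p z.1 - extChartAt (𝓡 4) p p)) Ψ) x := fun x hx =>
    MForm.restr_apply_of_mem (U := {x : punctured p | InPuncturedChartBall p ε' x}) _ hx
  have hΦout : ∀ x : punctured p, ¬ InPuncturedChartBall p ε' x → Φ x = 0 := fun x hx =>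
    MForm.restr_apply_of_notMem (U := {x : punctured p | InPuncturedChartBall p ε' x}) _ hx
  have hΦs : IsSmoothForm Φ := isSmoothForm_of_cutoffPullback hΦin hΦout hΨs hΨ0 hδ0 hδε' hδT
  have hΦc : IsClosedForm Φ :=
    isClosedForm_of_cutoffPullback hΦin hΦout hΨs hΨc hΨ0 hδ0 hδε' hδT
  have hΦstd : IsStandardOnBall p ε Φ := isStandardOnBall_of_cutoffPullback hΦin hΨ1 hεε'.le
  have hΦpos : ∀ (x : punctured p) (v : TangentSpace (𝓡 4) x), 0 ≤ Φ x ![v, J x v] :=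
    apply_J_nonneg_of_cutoffPullback hΦin hΦout hfnn hΨpos hJstd
  have hTΦ : T Φ = 0 :=
    le_antisymm (hT.nonpos_of_standard hΦs hΦc hΦstd)
      (stub_collar_positivity S p J ε T hT β hβ hβt Φ hΦs fun x _ v => hΦpos x v)
  -- the domination bound off the `ε`-ball and the constants
  obtain ⟨C, hC, hbound⟩ := stub_collar_domination S p J ε ε₂ ε' hε hε₂' hball hJstd α hα hα0
  set m : ℝ := f ((ε₂⁻¹) ^ 2) with hm
  have hm0 : 0 < m := hfpos _ ha₂
  set t : ℝ := m / (C + 1) with ht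
  have ht0 : 0 < t := div_pos hm0 (by linarith)
  have htC : t * C ≤ m := by
    rw [ht, div_mul_eq_mul_div, div_le_iff₀ (by linarith : (0 : ℝ) < C + 1)]
    nlinarith
  -- `Φ + σ t α` is `J`-semipositive off the ball for `σ = ± 1`, so `0 ≤ σ t T α`
  have key : ∀ σ : ℝ, |σ| = 1 → 0 ≤ σ * t * T α := by
    intro σ hσ
    have hsm : IsSmoothForm (Φ + (σ * t) • α) := hΦs.add (hα.smul _)
    have hsp : ∀ x : punctured p, ¬ InPuncturedChartBall p ε x →
        ∀ v : TangentSpace (𝓡 4) x, 0 ≤ (Φ + (σ * t) • α) x ![v, J x v] := by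
      intro x hx v
      show 0 ≤ (Φ x + (σ * t) • α x) ![v, J x v]
      rw [ContinuousAlternatingMap.add_apply, ContinuousAlternatingMap.smul_apply, smul_eq_mul]
      by_cases hαx : α x = 0
      · rw [hαx]
        simpa using hΦpos x v
      · have hx₂ : InPuncturedChartBall p ε₂ x := by
          by_contra h
          exact hαx (hα0 x h)
        have hx' : InPuncturedChartBall p ε' x := hx₂.mono hε₂'.le
        have hlt : ‖extChartAt (𝓡 4) p x.1 - extChartAt (𝓡 4) p p‖ < ε₂ := by
          have h := hx₂.2
          rwa [Metric.mem_ball, dist_eq_norm] at h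
        have hpos' : 0 < ‖extChartAt (𝓡 4) p x.1 - extChartAt (𝓡 4) p p‖ :=
          norm_pos_iff.2 (extChartAt_sub_ne_zero p hx₂.1)
        have hfge : m ≤ f (‖inversion (extChartAt (𝓡 4) p x.1 - extChartAt (𝓡 4) p p)‖ ^ 2) :=
          hfm (le_norm_sq_inversion hpos' hlt.le)
        have hΦge := le_apply_J_of_cutoffPullback hΦin hΨpos hJstd hx' v
        have hαle := hbound x hx v
        have h1 : |σ * t * α x ![v, J x v]| ≤ m *
            ‖fderiv ℝ inversion (extChartAt (𝓡 4) p x.1 - extChartAt (𝓡 4) p p)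
              (mfderiv (𝓡 4) 𝓘(ℝ, EuclideanSpace ℝ (Fin 4))
                (fun z : punctured p => extChartAt (𝓡 4) p z.1) x v)‖ ^ 2 := by
          rw [abs_mul, abs_mul, hσ, one_mul, abs_of_pos ht0]
          refine (mul_le_mul_of_nonneg_left hαle ht0.le).trans ?_
          rw [← mul_assoc]
          exact mul_le_mul_of_nonneg_right htC (sq_nonneg _)
        have h2 := neg_abs_le (σ * t * α x ![v, J x v])
        have h3 := mul_le_mul_of_nonneg_right hfge (sq_nonneg
          ‖fderiv ℝ inversion (extChartAt (𝓡 4) p x.1 - extChartAt (𝓡 4) p p)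
            (mfderiv (𝓡 4) 𝓘(ℝ, EuclideanSpace ℝ (Fin 4))
              (fun z : punctured p => extChartAt (𝓡 4) p z.1) x v)‖)
        linarith
    have h := stub_collar_positivity S p J ε T hT β hβ hβt _ hsm hsp
    rwa [map_add, map_smul, smul_eq_mul, hTΦ, zero_add] at h
  have h1 : 0 ≤ t * T α := by simpa using key 1 abs_one
  have h2 : 0 ≤ -(t * T α) := by
    have h := key (-1) (by simp)
    linarith
  have h5 : t * T α = 0 := le_antisymm (by linarith) h1
  exact (mul_eq_zero.1 h5).resolve_left ht0.ne'

end Summit.SmoothPoincare4.SmoothPoincare4.Theorems.WitnessCharge.PencilIncompleteness
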